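import Summits.CriticalPhenomena.PercolationContinuityZ3.Theorems.PercNearOneGluingNoHeavyRsw3SetToSetArmVisits
import Summits.CriticalPhenomena.PercolationContinuityZ3.Theorems.PercNearOneGluingNoHeavyRsw3SetToSetArmAvoids
import HarnessLib

/-!
# RSW3 lane (P2, gen 18): at `p_c(ℤ^d)`, under (A2)□, THE ARM IS MACROSCOPICALLY RANDOM — it VISITS and it AVOIDS every
# mesoscopic ball with conditional probability bounded below (constants of the two every-`p` inequalities)

builds on p205010 (kernel theorem, internal audit signed; external expert review pending) — NOT used in this file.

Cell `prim-rsw3`, prover seat `prim-rsw3-p2` (gen 18), memo `run/shared/lean/prim/rsw3/P2-RSWLITE.md` §25.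
Support file (`--supports stmt-CriticalPhenomena-4575`); no definitions, no named facts, no sorries.

Under Basu–Sapozhnikov's (A2)□ at `p_c(ℤ^d)` (`Crossing.SetToSetQuasiMultAspectAt d p_c s L ϰ`, `2 ≤ s ≤ L`, `ϰ > 0`, `d ≥ 2`), for
every `C` there is `c > 0` such that for all radii `m ≥ 8(L+1)`, centres `t` with `‖t‖_∞ ≤ C m`, and `n` beyond `L(‖t‖_∞ + m + 1) + 1`:
 * VISIT (`m ≤ ‖t‖_∞`): `P_{p_c}[0 ↔ ∂Λ(n) ∧ {0} ↔ Λ_t(m) in Λ(n)] ≥ c · π_{p_c}(n)`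
   (`exists_mul_oneArmProb_le_real_visits_of_setToSetQuasiMultAspectAt`);
 * AVOID (`2m ≤ ‖t‖_∞`): `P_{p_c}[{0} ↔ ∂ⁱⁿΛ(n) in Λ(n) ∖ Λ_t(m)] ≥ c · π_{p_c}(n)`
   (`exists_mul_oneArmProb_le_real_avoids_of_setToSetQuasiMultAspectAt`).
So, conditionally on the one-arm event to distance `n`, the cluster of the origin meets any prescribed mesoscopic ball with
probability `≥ c` and misses it with probability `≥ c`, uniformly in the scale: the pre-limit form of "Kesten's IIC has no empty and
no forced sectors" — in the plane both follow from RSW; here from the LANE-4 input alone, through the freedom of the region `Z` in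
(A2)□ (gated domain, resp. domain with the ball removed).  Window constants: `u(m', sm') ≥ (2d)⁻¹(4s)^{1-d}`,
`u(m', (2L+2)m') ≥ (2d)⁻¹(8L+8)^{1-d}` (`Rsw3.le_real_boxCrossing_mul_criticalProbI`).

References: D. Basu, A. Sapozhnikov, ECP 22 (2017) no. 26, §1 (A2) [BasuSapozhnikov2017ECP]; H. Kesten, Probab. Theory Relat.
Fields 73 (1986) 369–394 [Kesten1986]; G. Grimmett, *Percolation* (1999), §9.1, §11.7 [GrimmettPercolation1999]. [folklore]
-/

noncomputable section

namespace Summit.CriticalPhenomena.PercolationContinuityZ3.Theorems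

namespace Rsw3

open MeasureTheory Literature.Probability.LatticeModels Literature.Probability.Percolation
open SurfaceTension Crossing SimpleGraph

variable {d : ℕ}

/-! ## At `p_c(ℤ^d)`: the arm visits every mesoscopic ball -/

/-- **(A2)□ at `p_c(ℤ^d)` ⇒ the arm VISITS every mesoscopic ball** (`d ≥ 2`, `2 ≤ s ≤ L`, `ϰ > 0`, any `C`): there is
`c > 0` such that for every radius `m ≥ 8(L+1)`, every centre `t` with `m ≤ ‖t‖_∞ ≤ C m` (`i` a coordinate of maximal modulus) and
every `n ≥ L(‖t‖_∞ + 1) + 1`: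
`c · π_{p_c}(n) ≤ P_{p_c}[{0 ↔ ∂Λ(n)} ∩ {{0} ↔ Λ_t(m) in Λ(n)}]` — conditionally on the one-arm event to distance `n`, the cluster
of the origin meets the ball `Λ_t(m)` with probability `≥ c`, uniformly in the scale (the pre-limit form of "Kesten's IIC has no
empty sectors"; in the plane a consequence of RSW). [cite: BasuSapozhnikov2017ECP, §1 assumption (A2)] [cite: Kesten1986, Thm. 3] -/
theorem exists_mul_oneArmProb_le_real_visits_of_setToSetQuasiMultAspectAt (hd : 2 ≤ d) {s L : ℕ} {ϰ : ℝ}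
    (h : SetToSetQuasiMultAspectAt d (criticalProbI d) s L ϰ) (hϰ : 0 < ϰ) (hs : 2 ≤ s) (hsL : s ≤ L)
    (C : ℕ) :
    ∃ c : ℝ, 0 < c ∧ ∀ (m : ℕ) (t : Site d) (i : Fin d) (n : ℕ), 8 * (L + 1) ≤ m →
      (∀ j, (t j).natAbs ≤ (t i).natAbs) → m ≤ (t i).natAbs → (t i).natAbs ≤ C * m →
      L * ((t i).natAbs + 1) + 1 ≤ n →
        c * oneArmProb d (criticalProbI d) n ≤ (bondPercolation (zdGraph d) (criticalProbI d)).real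
          (siteToBoundary d n ∩
            openCrossing (↑(box d n) : Set (Site d)) ↑({(0 : Site d)} : Finset (Site d)) ↑(GM.ball t m)) := by
  classical
  have hd1 : 1 ≤ d := by omega
  set pc : unitInterval := criticalProbI d with hpcdef
  have hpc : 0 < (pc : ℝ) := by rw [hpcdef, coe_criticalProbI]; exact criticalProb_zd_pos d hd1
  have hdpos : (0 : ℝ) < d := by exact_mod_cast (show 0 < d by omega)
  have hd0 : (0 : ℝ) < 2 * d := by linarith
  -- window constants
  set u₀ : ℝ := (2 * (d : ℝ))⁻¹ * ((4 * (s : ℝ)) ^ (d - 1))⁻¹ with hu₀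
  set v₀ : ℝ := (2 * (d : ℝ))⁻¹ * ((4 * ((2 * L + 2 : ℕ) : ℝ)) ^ (d - 1))⁻¹ with hv₀
  have hs0 : (0 : ℝ) < s := by exact_mod_cast (show 0 < s by omega)
  have hL0 : (0 : ℝ) < ((2 * L + 2 : ℕ) : ℝ) := by exact_mod_cast (show 0 < 2 * L + 2 by omega)
  have hu₀pos : 0 < u₀ := by positivity
  have hv₀pos : 0 < v₀ := by positivity
  have hu : ∀ m', 1 ≤ m' → u₀ ≤ (bondPercolation (zdGraph d) pc).real (boxCrossing d m' (s * m')) :=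
    fun m' hm' => le_real_boxCrossing_mul_criticalProbI hd (by omega) hm'
  have hv : ∀ m', 1 ≤ m' → v₀ ≤ (bondPercolation (zdGraph d) pc).real (boxCrossing d m' ((2 * L + 2) * m')) :=
    fun m' hm' => le_real_boxCrossing_mul_criticalProbI hd (by omega) hm'
  -- constants
  obtain ⟨P, hP⟩ : ∃ P : ℕ, P = 8 * (L + 1) := ⟨_, rfl⟩
  obtain ⟨K, hK⟩ : ∃ K : ℕ, K = s * (2 * C * P + 1) := ⟨_, rfl⟩
  set c : ℝ := ϰ ^ 2 * (ϰ * u₀) ^ (K + 1) * (v₀ / (2 * d)) with hc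
  have hcpos : 0 < c := by positivity
  refine ⟨c, hcpos, fun m t i n hm hmax hmN hNC hn => ?_⟩
  obtain ⟨N, hN⟩ : ∃ N : ℕ, N = (t i).natAbs := ⟨_, rfl⟩
  rw [← hN] at hmax hmN hNC hn
  -- the chain scale `m' = ⌊m/P⌋ ≥ 1` and the offset `q = (2L+2) m'`
  obtain ⟨m', hm'⟩ : ∃ m' : ℕ, m' = m / P := ⟨_, rfl⟩
  have hP0 : 0 < P := by omega
  have hm'1 : 1 ≤ m' := by rw [hm']; exact (Nat.le_div_iff_mul_le hP0).2 (by omega)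
  have hdm := Nat.div_add_mod m P
  have hml := Nat.mod_lt m hP0
  rw [← hm'] at hdm
  have hPm' : P * m' = 8 * ((L + 1) * m') := by rw [hP]; ring
  have hL1 : (L + 1) * m' = L * m' + m' := by ring
  obtain ⟨q, hq⟩ : ∃ q : ℕ, q = (2 * L + 2) * m' := ⟨_, rfl⟩
  have hq' : q = 2 * (L * m') + 2 * m' := by rw [hq]; ring
  have h44 : (4 * L + 4) * m' = 4 * (L * m') + 4 * m' := by ring
  have hqN : q ≤ N := by omega
  obtain ⟨W, hW⟩ : ∃ W : ℕ, W = N - q := ⟨_, rfl⟩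
  have hWq : W + q = N := by omega
  -- sign
  obtain ⟨ε, hε⟩ : ∃ ε : ℤˣ, (ε : ℤ) * t i = ((W + q : ℕ) : ℤ) := by
    rcases le_or_gt 0 (t i) with h0 | h0
    · exact ⟨1, by rw [Units.val_one, one_mul, hWq, hN]; omega⟩
    · exact ⟨-1, by rw [Units.val_neg, Units.val_one, hWq, hN]; omega⟩
  -- `s (W+1) ≤ K m'`
  have hCm : C * m = C * (P * m') + C * (m % P) := by rw [← Nat.mul_add, hdm]
  have hCmod : C * (m % P) ≤ C * P := Nat.mul_le_mul_left C hml.le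
  have hCP1 : C * P + 1 ≤ (C * P + 1) * m' := Nat.le_mul_of_pos_right _ hm'1
  have hW1 : W + 1 ≤ (2 * C * P + 1) * m' := by
    have h1 : (2 * C * P + 1) * m' = C * (P * m') + (C * P + 1) * m' := by ring
    rw [h1]; omega
  have hKm : s * (W + 1) ≤ K * m' := by
    rw [hK, mul_assoc]; exact Nat.mul_le_mul_left s hW1
  have hcore := mul_oneArmProb_le_oneArmProb_mul_real_visits hd1 h hϰ.le hs hsL t i ε (m := m) (m' := m') (q := q)
    (W := W) (n := n) (K := K) hm'1 hε (fun j => by rw [hWq]; exact hmax j) (by omega) (by omega)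
    (le_trans (Nat.add_le_add_right (Nat.mul_le_mul_left L (by omega)) 1) hn) hKm
  -- compare constants
  set μ := bondPercolation (zdGraph d) pc with hμ
  have hq₁ : ϰ * u₀ ≤ ϰ * μ.real (boxCrossing d m' (s * m')) := mul_le_mul_of_nonneg_left (hu m' hm'1) hϰ.le
  have hpow : (ϰ * u₀) ^ (K + 1) ≤ (ϰ * μ.real (boxCrossing d m' (s * m'))) ^ (K + 1) :=
    pow_le_pow_left₀ (by positivity) hq₁ _
  have hv₂ : v₀ / (2 * d) ≤ μ.real (boxCrossing d m' ((2 * L + 2) * m')) / (2 * d) :=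
    div_le_div_of_nonneg_right (hv m' hm'1) hd0.le
  have hπ : oneArmProb d pc (s * (W + 1)) ≤ oneArmProb d pc (s * m') :=
    DCT16.real_siteToBoundary_antitone pc (Nat.mul_le_mul_left s (by omega))
  have hπsM : 0 < oneArmProb d pc (s * (W + 1)) :=
    (pow_pos hpc _).trans_le (DKT20.pow_le_real_siteToBoundary hd1 pc _)
  have hπn0 : 0 ≤ oneArmProb d pc n := measureReal_nonneg
  have hkey : oneArmProb d pc (s * (W + 1)) * (c * oneArmProb d pc n) ≤
      oneArmProb d pc (s * (W + 1)) * μ.real (siteToBoundary d n ∩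
        openCrossing (↑(box d n) : Set (Site d)) ↑({(0 : Site d)} : Finset (Site d)) ↑(GM.ball t m)) := by
    refine le_trans ?_ hcore
    have hQ0 : 0 ≤ (ϰ * μ.real (boxCrossing d m' (s * m'))) ^ (K + 1) :=
      pow_nonneg (mul_nonneg hϰ.le measureReal_nonneg) _
    have hA : (ϰ * u₀) ^ (K + 1) * (v₀ / (2 * d)) ≤
        (ϰ * μ.real (boxCrossing d m' (s * m'))) ^ (K + 1) * (μ.real (boxCrossing d m' ((2 * L + 2) * m')) / (2 * d)) :=
      mul_le_mul hpow hv₂ (div_nonneg hv₀pos.le hd0.le) hQ0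
    have hB : (ϰ * u₀) ^ (K + 1) * (v₀ / (2 * d)) * oneArmProb d pc (s * (W + 1)) ≤
        (ϰ * μ.real (boxCrossing d m' (s * m'))) ^ (K + 1) * (μ.real (boxCrossing d m' ((2 * L + 2) * m')) / (2 * d)) *
          oneArmProb d pc (s * m') :=
      mul_le_mul hA hπ measureReal_nonneg (mul_nonneg hQ0 (div_nonneg measureReal_nonneg hd0.le))
    have hϰπ : 0 ≤ ϰ ^ 2 * oneArmProb d pc n := mul_nonneg (pow_nonneg hϰ.le 2) hπn0
    calc oneArmProb d pc (s * (W + 1)) * (c * oneArmProb d pc n)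
        = ϰ ^ 2 * oneArmProb d pc n * ((ϰ * u₀) ^ (K + 1) * (v₀ / (2 * d)) * oneArmProb d pc (s * (W + 1))) := by
          rw [hc]; ring
      _ ≤ ϰ ^ 2 * oneArmProb d pc n * ((ϰ * μ.real (boxCrossing d m' (s * m'))) ^ (K + 1) *
            (μ.real (boxCrossing d m' ((2 * L + 2) * m')) / (2 * d)) * oneArmProb d pc (s * m')) :=
          mul_le_mul_of_nonneg_left hB hϰπ
      _ = _ := by ring
  exact le_of_mul_le_mul_left hkey hπsM

/-! ## At `p_c(ℤ^d)`: the arm avoids every mesoscopic ball -/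

/-- **(A2)□ at `p_c(ℤ^d)` ⇒ the arm AVOIDS every mesoscopic ball** (`d ≥ 2`, `2 ≤ s ≤ L`, `ϰ > 0`, any `C`): there is `c > 0`
such that for every radius `m ≥ 8(L+1)`, every centre `t` with `2m ≤ ‖t‖_∞ ≤ C m` and every `n ≥ L(‖t‖_∞ + m + 1) + 1`:
`c · π_{p_c}(n) ≤ P_{p_c}[{0} ↔ ∂ⁱⁿΛ(n) in Λ(n) ∖ Λ_t(m)]` — conditionally on the one-arm event, the cluster of the origin reaches
`∂Λ(n)` without touching `Λ_t(m)` with probability `≥ c`. [cite: BasuSapozhnikov2017ECP, §1 assumption (A2)] [cite: Kesten1986, Thm. 3] -/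
theorem exists_mul_oneArmProb_le_real_avoids_of_setToSetQuasiMultAspectAt (hd : 2 ≤ d) {s L : ℕ} {ϰ : ℝ}
    (h : SetToSetQuasiMultAspectAt d (criticalProbI d) s L ϰ) (hϰ : 0 < ϰ) (hs : 2 ≤ s) (hsL : s ≤ L)
    (C : ℕ) :
    ∃ c : ℝ, 0 < c ∧ ∀ (m : ℕ) (t : Site d) (i : Fin d) (n : ℕ), 8 * (L + 1) ≤ m →
      (∀ j, (t j).natAbs ≤ (t i).natAbs) → 2 * m ≤ (t i).natAbs → (t i).natAbs ≤ C * m →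
      L * ((t i).natAbs + m + 1) + 1 ≤ n →
        c * oneArmProb d (criticalProbI d) n ≤ (bondPercolation (zdGraph d) (criticalProbI d)).real
          (openCrossing (↑(box d n \ GM.ball t m) : Set (Site d)) ↑({(0 : Site d)} : Finset (Site d))
            ↑(innerBoundary (zdGraph d) (box d n))) := by
  classical
  have hd1 : 1 ≤ d := by omega
  set pc : unitInterval := criticalProbI d with hpcdef
  have hpc : 0 < (pc : ℝ) := by rw [hpcdef, coe_criticalProbI]; exact criticalProb_zd_pos d hd1
  have hdpos : (0 : ℝ) < d := by exact_mod_cast (show 0 < d by omega)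
  have hd0 : (0 : ℝ) < 2 * d := by linarith
  set u₀ : ℝ := (2 * (d : ℝ))⁻¹ * ((4 * (s : ℝ)) ^ (d - 1))⁻¹ with hu₀
  set v₀ : ℝ := (2 * (d : ℝ))⁻¹ * ((4 * ((2 * L + 2 : ℕ) : ℝ)) ^ (d - 1))⁻¹ with hv₀
  have hs0 : (0 : ℝ) < s := by exact_mod_cast (show 0 < s by omega)
  have hL0 : (0 : ℝ) < ((2 * L + 2 : ℕ) : ℝ) := by exact_mod_cast (show 0 < 2 * L + 2 by omega)
  have hu₀pos : 0 < u₀ := by positivity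
  have hv₀pos : 0 < v₀ := by positivity
  have hu : ∀ m', 1 ≤ m' → u₀ ≤ (bondPercolation (zdGraph d) pc).real (boxCrossing d m' (s * m')) :=
    fun m' hm' => le_real_boxCrossing_mul_criticalProbI hd (by omega) hm'
  have hv : ∀ m', 1 ≤ m' → v₀ ≤ (bondPercolation (zdGraph d) pc).real (boxCrossing d m' ((2 * L + 2) * m')) :=
    fun m' hm' => le_real_boxCrossing_mul_criticalProbI hd (by omega) hm'
  obtain ⟨P, hP⟩ : ∃ P : ℕ, P = 8 * (L + 1) := ⟨_, rfl⟩
  obtain ⟨K, hK⟩ : ∃ K : ℕ, K = s * (2 * (C + 1) * P + 1) := ⟨_, rfl⟩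
  set c : ℝ := ϰ ^ 2 * (ϰ * u₀) ^ (K + 1) * (v₀ / (2 * d)) with hc
  have hcpos : 0 < c := by positivity
  refine ⟨c, hcpos, fun m t i n hm hmax hmN hNC hn => ?_⟩
  obtain ⟨N, hN⟩ : ∃ N : ℕ, N = (t i).natAbs := ⟨_, rfl⟩
  rw [← hN] at hmax hmN hNC hn
  obtain ⟨m', hm'⟩ : ∃ m' : ℕ, m' = m / P := ⟨_, rfl⟩
  have hP0 : 0 < P := by omega
  have hm'1 : 1 ≤ m' := by rw [hm']; exact (Nat.le_div_iff_mul_le hP0).2 (by omega)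
  have hdm := Nat.div_add_mod m P
  have hml := Nat.mod_lt m hP0
  rw [← hm'] at hdm
  have hPm' : P * m' = 8 * ((L + 1) * m') := by rw [hP]; ring
  have hL1 : (L + 1) * m' = L * m' + m' := by ring
  have h22 : (2 * L + 2) * m' = 2 * (L * m') + 2 * m' := by ring
  obtain ⟨ε, hε⟩ : ∃ ε : ℤˣ, (ε : ℤ) * t i = (N : ℤ) := by
    rcases le_or_gt 0 (t i) with h0 | h0
    · exact ⟨1, by rw [Units.val_one, one_mul, hN]; omega⟩
    · exact ⟨-1, by rw [Units.val_neg, Units.val_one, hN]; omega⟩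
  -- `s (N+m+1) ≤ K m'`
  have hCm : (C + 1) * m = (C + 1) * (P * m') + (C + 1) * (m % P) := by rw [← Nat.mul_add, hdm]
  have hCmod : (C + 1) * (m % P) ≤ (C + 1) * P := Nat.mul_le_mul_left (C + 1) hml.le
  have hCP1 : (C + 1) * P + 1 ≤ ((C + 1) * P + 1) * m' := Nat.le_mul_of_pos_right _ hm'1
  have hC1m : (C + 1) * m = C * m + m := by ring
  have hW1 : N + m + 1 ≤ (2 * (C + 1) * P + 1) * m' := by
    have h1 : (2 * (C + 1) * P + 1) * m' = (C + 1) * (P * m') + ((C + 1) * P + 1) * m' := by ring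
    rw [h1]; omega
  have hKm : s * (N + m + 1) ≤ K * m' := by
    rw [hK, mul_assoc]; exact Nat.mul_le_mul_left s hW1
  have hcore := mul_oneArmProb_le_oneArmProb_mul_real_avoids hd1 h hϰ.le hs hsL t i ε (m := m) (m' := m') (N := N)
    (n := n) (K := K) hm'1 hε hmax (by omega) hn hKm
  set μ := bondPercolation (zdGraph d) pc with hμ
  have hq₁ : ϰ * u₀ ≤ ϰ * μ.real (boxCrossing d m' (s * m')) := mul_le_mul_of_nonneg_left (hu m' hm'1) hϰ.le
  have hpow : (ϰ * u₀) ^ (K + 1) ≤ (ϰ * μ.real (boxCrossing d m' (s * m'))) ^ (K + 1) :=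
    pow_le_pow_left₀ (by positivity) hq₁ _
  have hv₂ : v₀ / (2 * d) ≤ μ.real (boxCrossing d m' ((2 * L + 2) * m')) / (2 * d) :=
    div_le_div_of_nonneg_right (hv m' hm'1) hd0.le
  have hπ : oneArmProb d pc (s * (N + m + 1)) ≤ oneArmProb d pc (s * m') :=
    DCT16.real_siteToBoundary_antitone pc (Nat.mul_le_mul_left s (by omega))
  have hπsM : 0 < oneArmProb d pc (s * (N + m + 1)) :=
    (pow_pos hpc _).trans_le (DKT20.pow_le_real_siteToBoundary hd1 pc _)
  have hπn0 : 0 ≤ oneArmProb d pc n := measureReal_nonneg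
  have hkey : oneArmProb d pc (s * (N + m + 1)) * (c * oneArmProb d pc n) ≤
      oneArmProb d pc (s * (N + m + 1)) * μ.real
        (openCrossing (↑(box d n \ GM.ball t m) : Set (Site d)) ↑({(0 : Site d)} : Finset (Site d))
          ↑(innerBoundary (zdGraph d) (box d n))) := by
    refine le_trans ?_ hcore
    have hQ0 : 0 ≤ (ϰ * μ.real (boxCrossing d m' (s * m'))) ^ (K + 1) :=
      pow_nonneg (mul_nonneg hϰ.le measureReal_nonneg) _
    have hA : (ϰ * u₀) ^ (K + 1) * (v₀ / (2 * d)) ≤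
        (ϰ * μ.real (boxCrossing d m' (s * m'))) ^ (K + 1) * (μ.real (boxCrossing d m' ((2 * L + 2) * m')) / (2 * d)) :=
      mul_le_mul hpow hv₂ (div_nonneg hv₀pos.le hd0.le) hQ0
    have hB : (ϰ * u₀) ^ (K + 1) * (v₀ / (2 * d)) * oneArmProb d pc (s * (N + m + 1)) ≤
        (ϰ * μ.real (boxCrossing d m' (s * m'))) ^ (K + 1) * (μ.real (boxCrossing d m' ((2 * L + 2) * m')) / (2 * d)) *
          oneArmProb d pc (s * m') :=
      mul_le_mul hA hπ measureReal_nonneg (mul_nonneg hQ0 (div_nonneg measureReal_nonneg hd0.le))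
    have hϰπ : 0 ≤ ϰ ^ 2 * oneArmProb d pc n := mul_nonneg (pow_nonneg hϰ.le 2) hπn0
    calc oneArmProb d pc (s * (N + m + 1)) * (c * oneArmProb d pc n)
        = ϰ ^ 2 * oneArmProb d pc n * ((ϰ * u₀) ^ (K + 1) * (v₀ / (2 * d)) * oneArmProb d pc (s * (N + m + 1))) := by
          rw [hc]; ring
      _ ≤ ϰ ^ 2 * oneArmProb d pc n * ((ϰ * μ.real (boxCrossing d m' (s * m'))) ^ (K + 1) *
            (μ.real (boxCrossing d m' ((2 * L + 2) * m')) / (2 * d)) * oneArmProb d pc (s * m')) :=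
          mul_le_mul_of_nonneg_left hB hϰπ
      _ = _ := by ring
  exact le_of_mul_le_mul_left hkey hπsM

end Rsw3

end Summit.CriticalPhenomena.PercolationContinuityZ3.Theorems
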